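import Summits.RiemannHypothesis.RiemannHypothesis.Theorems.HandoffBottomCriterion
import Summits.RiemannHypothesis.RiemannHypothesis.Theorems.HandoffLossyStep
import Literature.NumberTheory.LFunctions.GeneralizedRH
import HarnessLib

/-!
# The GRADED bottom-growth criterion: «`ε(t) ≥ −C·e^{2αt}` eventually ⟹ no zeros with `Re ρ > ½ + α`»

Cell `rh-explicit`, TRACK «HANDOFF», seat handoff-theory-1 (definitions + logic), gen4.  Companion text:
`HOME/handoff/HANDOFF-STATEMENT.md` §J.4 (MODEL dictionary «drop exponent = Θ − ½; a power saving `Q^a` in the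
accumulated drop ↔ a zero-free half-plane `Re s > ½ + a`»), §J.9 (LEMMA L PROVED ON PAPER; idea-1 gen5
`WEIL-BOTTOM-UNBOUNDED.md` Cor. 3 and idea-2 gen4 L10′ state the GRADED form: for every `α ≥ 0`,
«`∃ C t₀, ∀ t ≥ t₀, ε(t) ≥ −C·e^{2αt}` ⟹ `ζ(s) ≠ 0` for `Re s > ½ + α`»).  Builds on this seat's
`HandoffBottomCriterion.lean` (`WeilBottomDropOfOffLineZero`, the `α = 0` kernel target) and `HandoffLossyStep.lean`
(`HandoffStepLossy`, telescoping of per-prime losses), and on the tree's `QuasiRiemannHypothesis σ₀`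
(`Literature/NumberTheory/LFunctions/GeneralizedRH.lean`: no zeros with `σ₀ < Re s < 1`; `σ₀ = ½` is RH).

HONEST FRAMING.  Nothing here is a step towards RH, and the graded LEMMA L is NOT proved here: it is the analytic
input, stated as the `Prop` `WeilBottomExpDropOfZero` (a prover files `theorem weilBottomExpDropOfZero_holds`; the paper
proof is the `α = 0` proof with the Landau abscissa moved from `0` to `a` — the comparison function gains one term
`C′e^{aL}` whose transform `C′/(w − a)` has its pole AT the abscissa, and the `w = ½` cancellation is unchanged).
What IS proved is the logic that makes it the right input and turns §J.4's MODEL dictionary into CONDITIONAL theorems: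
* §1 `weilBottomDropOfOffLineZero_of_expDrop` — the graded Prop contains the `α = 0` Prop (so ONE kernel proof of the
  graded form discharges both files);
* §2 the growth classes `WeilBottomGrowthLE α` («the negative part of the window bottom grows at most like `e^{2αt}`»):
  RH-implied for every `α` (unconditional), monotone in `α`; GRANTED the graded lemma:
  `WeilBottomGrowthLE α ⟹ QuasiRiemannHypothesis (½ + α)` (`quasiRiemannHypothesis_of_weilBottomGrowthLE`), and
  **`RH ↔ ∀ α > 0, WeilBottomGrowthLE α`** («RH is: the negative part of the Weil window bottom grows sub-exponentially»,
  `riemannHypothesis_iff_forall_weilBottomGrowthLE`) next to file V's `RH ↔ WeilBottomGrowthLE 0`-shape;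
* §3 the PRIME-INDEXED reading (unconditional bookkeeping, Bertrand): `WeilBottomGrowthLE α ↔ ∃ C q₀, ∀ primes
  q ≥ q₀, −C·q^α ≤ ε((log q)/2)` — the form in which the handoff ladder / theory-2's deficit data read it;
* §4 the GRADED DOOR: a rung with loss at a prime `q₀` and lossy increments `StepLossy(q, δ_q)` whose ACCUMULATED loss
  is power-bounded, `Σ_{q₀ ≤ p < Q} δ_p ≤ D·Q^a`, give `WeilBottomGrowthLE a` (unconditional telescoping), hence
  `QuasiRiemannHypothesis (½ + a)` GRANTED the graded lemma (`quasiRiemannHypothesis_of_powerBounded_loss`); `a = 0` is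
  file II's `riemannHypothesis_of_bounded_loss`.  HONEST SIZE (unchanged): the trivial modulus `cap(q) = (log q)/√q`
  accumulates to `≍ √Q`, i.e. `a = ½`, which is the vacuous `QuasiRiemannHypothesis 1`; any `a < ½` is a genuine
  power saving in a one-sided smoothed Chebyshev bound (§J.9 (3)).

References: Montgomery–Vaughan 2007, Lemma 15.1 / Thm 15.2 (Landau's method) [MontgomeryVaughan2007]; Iwaniec–Kowalski
§5.7 (quasi-RH) [folklore]; Bombieri 2000 §4 (the window bottom) [Bombieri2000Weil]; this track HANDOFF-STATEMENT §J,
idea-1 WEIL-BOTTOM-UNBOUNDED.md Cor. 3, idea-2 IDEAS-explicit-sieve.md §IV.2 L10′.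
-/

set_option linter.dupNamespace false  -- the mandated namespace repeats `RiemannHypothesis`

noncomputable section

open Set Filter Literature.NumberTheory.LFunctions

namespace Summit.RiemannHypothesis.RiemannHypothesis.Theorems.HandoffDecomposition

variable {α β : ℝ}

/-! ## §1  The graded Lemma L as a `Prop`, and its relation to the `α = 0` target -/

/-- **GRADED LEMMA L, as a `Prop` (analytic input; PROVED ON PAPER by idea-1 gen5 Cor. 3 / idea-2 gen4 L10′; NOT yet in
the tree)**: a zero `ρ` of `ζ` with `½ + a < Re ρ < 1`, `a ≥ 0`, makes the window bottom `ε = weilGroundEnergy` drop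
below `−C·e^{2at}` on arbitrarily large windows, for every `C`.  (Paper proof: the symmetric-bump-pair identity of
idea-1 §2 / theory-2's `HandoffDipoleChebyshev.lean` bounds a smoothed `√x`-normalised Chebyshev remainder from above by
`const + C·x^a` if the conclusion fails; Landau's lemma on the Laplace transform in `L = log x` with abscissa `a` meets
the pole of `−(ζ′/ζ)(w + ½)` at `w = ρ − ½`, `Re = Re ρ − ½ > a`.)  For `a = 0` this is file V's
`WeilBottomDropOfOffLineZero` (`weilBottomDropOfOffLineZero_of_expDrop`).  A statement of THIS track pending
kernel-check, not a literature fact. [this track: idea-1 WEIL-BOTTOM-UNBOUNDED.md Cor. 3, idea-2 L10′ (paper);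
MontgomeryVaughan2007 Thm. 15.2 (method)] -/
def WeilBottomExpDropOfZero : Prop :=
  ∀ ρ : ℂ, riemannZeta ρ = 0 → ∀ a : ℝ, 0 ≤ a → 1 / 2 + a < ρ.re → ρ.re < 1 →
    ∀ C T : ℝ, ∃ t : ℝ, T ≤ t ∧ weilGroundEnergy t < -C * Real.exp (2 * a * t)

/-- **The graded Prop contains the `α = 0` Prop** (take `a = 0`, `T = 1`). So a kernel proof of the graded form
discharges `WeilBottomDropOfOffLineZero`, hence `WeilBottomBoundedCriterion` and every CONDITIONAL theorem of files I/II/V.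
[this track (theory-1 gen4)] -/
theorem weilBottomDropOfOffLineZero_of_expDrop (hL : WeilBottomExpDropOfZero) : WeilBottomDropOfOffLineZero := by
  intro ρ hρ h1 h2 C
  obtain ⟨t, ht, hlt⟩ := hL ρ hρ 0 le_rfl (by simpa using h1) h2 C 1
  exact ⟨t, lt_of_lt_of_le one_pos ht, by simpa using hlt⟩

/-- Granted the graded lemma, the bounded criterion of file I holds. [this track (theory-1 gen4)] -/
theorem weilBottomBoundedCriterion_of_expDrop (hL : WeilBottomExpDropOfZero) : WeilBottomBoundedCriterion :=
  weilBottomBoundedCriterion_iff_dropOfOffLineZero.2 (weilBottomDropOfOffLineZero_of_expDrop hL)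

/-! ## §2  Growth classes of the negative part of the bottom, and the zero-free half-planes they give -/

/-- **`WeilBottomGrowthLE α`**: the negative part of the Weil window bottom grows at most like `e^{2αt}` —
`∃ C T, ∀ t ≥ T, −C·e^{2αt} ≤ ε(t)`.  `α = 0` is «`ε` eventually bounded below» (file V:
`RH ↔` that, granted Lemma L).  In the window variable `x = e^{2t}` (the length of the prime sum seen on `C(t)`) this is
`ε ≥ −C·x^α`.  A statement of THIS track (HANDOFF-STATEMENT §J.4/§J.9), not a literature fact. [this track (theory-1 gen4)] -/
def WeilBottomGrowthLE (α : ℝ) : Prop :=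
  ∃ C T : ℝ, ∀ t : ℝ, T ≤ t → -C * Real.exp (2 * α * t) ≤ weilGroundEnergy t

/-- Normalisation: the constant may be taken `≥ 0` and the threshold `≥ 0`. [this track (theory-1 gen4)] -/
theorem WeilBottomGrowthLE.exists_nonneg (h : WeilBottomGrowthLE α) :
    ∃ C T : ℝ, 0 ≤ C ∧ 0 ≤ T ∧ ∀ t : ℝ, T ≤ t → -C * Real.exp (2 * α * t) ≤ weilGroundEnergy t := by
  obtain ⟨C, T, h⟩ := h
  refine ⟨max C 0, max T 0, le_max_right _ _, le_max_right _ _, fun t ht ↦ ?_⟩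
  have h1 := h t ((le_max_left _ _).trans ht)
  have h2 : -(max C 0) * Real.exp (2 * α * t) ≤ -C * Real.exp (2 * α * t) :=
    mul_le_mul_of_nonneg_right (neg_le_neg (le_max_left _ _)) (Real.exp_nonneg _)
  exact h2.trans h1

/-- **RH-implied, for every rate** (under RH every window bottom is `≥ 0`). [cite: Bombieri2000Weil, Thm. 2; this track (theory-1 gen4)] -/
theorem weilBottomGrowthLE_of_riemannHypothesis (hRH : Summit.RiemannHypothesis) (α : ℝ) : WeilBottomGrowthLE α := by
  refine ⟨1, 1, fun t ht ↦ ?_⟩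
  have ht0 : 0 < t := lt_of_lt_of_le one_pos ht
  have h0 : 0 ≤ weilGroundEnergy t := (weilGroundEnergy_nonneg_iff_holds ht0).2 (MotivicDoor.Rungs.rung_R0.1 hRH _ ht0)
  have : 0 ≤ Real.exp (2 * α * t) := Real.exp_nonneg _
  nlinarith

/-- Monotone in the rate. [this track (theory-1 gen4)] -/
theorem WeilBottomGrowthLE.mono (h : WeilBottomGrowthLE α) (hαβ : α ≤ β) : WeilBottomGrowthLE β := by
  obtain ⟨C, T, hC, hT, h⟩ := h.exists_nonneg
  refine ⟨C, T, fun t ht ↦ ?_⟩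
  have ht0 : 0 ≤ t := hT.trans ht
  have hexp : Real.exp (2 * α * t) ≤ Real.exp (2 * β * t) :=
    Real.exp_le_exp.2 (by nlinarith)
  have := h t ht
  nlinarith

/-- **GRANTED THE GRADED LEMMA: growth rate `α` ⟹ the zero-free half-plane `Re s > ½ + α`**
(`QuasiRiemannHypothesis (½ + α)`: no zeros with `½ + α < Re s < 1`).  This is idea-1 Cor. 3 / idea-2 L10′ with the
analytic content isolated in `WeilBottomExpDropOfZero`. [this track (theory-1 gen4) — conditional on the graded lemma] -/
theorem quasiRiemannHypothesis_of_weilBottomGrowthLE (hL : WeilBottomExpDropOfZero) (hα : 0 ≤ α)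
    (h : WeilBottomGrowthLE α) : QuasiRiemannHypothesis (1 / 2 + α) := by
  intro s hs h1 h2
  obtain ⟨C, T, hCT⟩ := h
  obtain ⟨t, ht, hlt⟩ := hL s hs α hα h1 h2 C T
  exact absurd (hCT t ht) (not_le.2 hlt)

/-- **GRANTED THE GRADED LEMMA: rate `0` is RH** (file V's `riemannHypothesis_iff_eventually_ge_of_dropOfOffLineZero`,
re-read through §1). [this track (theory-1 gen4) — conditional on the graded lemma] -/
theorem riemannHypothesis_iff_weilBottomGrowthLE_zero (hL : WeilBottomExpDropOfZero) :
    Summit.RiemannHypothesis ↔ WeilBottomGrowthLE 0 := by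
  rw [riemannHypothesis_iff_eventually_ge_of_dropOfOffLineZero (weilBottomDropOfOffLineZero_of_expDrop hL)]
  simp only [WeilBottomGrowthLE, mul_zero, zero_mul, Real.exp_zero, mul_one]

/-- No zeros with `Re s > ½ + α` for EVERY `α > 0` is already no zeros with `Re s > ½`. [folklore] -/
theorem quasiRiemannHypothesis_half_of_forall_pos
    (h : ∀ α : ℝ, 0 < α → QuasiRiemannHypothesis (1 / 2 + α)) : QuasiRiemannHypothesis (1 / 2) := by
  intro s hs h1 h2
  exact h ((s.re - 1 / 2) / 2) (by linarith) s hs (by linarith) h2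

/-- **GRANTED THE GRADED LEMMA: `RH ↔` the negative part of the Weil window bottom grows SUB-EXPONENTIALLY**
(`∀ α > 0, ∃ C T, ∀ t ≥ T, ε(t) ≥ −C·e^{2αt}`).  ⇒ is unconditional (`weilBottomGrowthLE_of_riemannHypothesis`);
⇐: each rate `α > 0` clears the half-plane `Re s > ½ + α`, their union is `Re s > ½`, and `QuasiRiemannHypothesis (½)`
is RH (`quasiRiemannHypothesis_one_half_iff_holds`, functional equation).  HANDOFF-STATEMENT §J.9 (3), typed.
[this track (theory-1 gen4) — conditional on the graded lemma; DavenportMNT1980 ch. 8 for the last step] -/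
theorem riemannHypothesis_iff_forall_weilBottomGrowthLE (hL : WeilBottomExpDropOfZero) :
    Summit.RiemannHypothesis ↔ ∀ α : ℝ, 0 < α → WeilBottomGrowthLE α := by
  refine ⟨fun hRH α _ ↦ weilBottomGrowthLE_of_riemannHypothesis hRH α, fun h ↦ ?_⟩
  rw [Summit.RiemannHypothesis_iff]
  exact quasiRiemannHypothesis_one_half_iff_holds.1 (quasiRiemannHypothesis_half_of_forall_pos fun α hα ↦
    quasiRiemannHypothesis_of_weilBottomGrowthLE hL hα.le (h α hα))

/-- **The drop exponent dominates the excess of every zero** («`θ_drop ≥ Θ − ½`», HANDOFF-STATEMENT §J.4 dictionary,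
GRANTED the graded lemma): a zero `ρ` forbids every growth class `WeilBottomGrowthLE a` with `0 ≤ a < Re ρ − ½`
(non-vacuous exactly for the zeros right of the critical line). [this track (theory-1 gen4) — conditional on the graded lemma] -/
theorem not_weilBottomGrowthLE_of_zero (hL : WeilBottomExpDropOfZero) {ρ : ℂ} (hρ : riemannZeta ρ = 0)
    {a : ℝ} (ha : 0 ≤ a) (ha' : a < ρ.re - 1 / 2) : ¬ WeilBottomGrowthLE a := by
  intro hG
  have h2 : ρ.re < 1 := by
    by_contra hge
    exact riemannZeta_ne_zero_of_one_le_re (not_lt.1 hge) hρ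
  exact quasiRiemannHypothesis_of_weilBottomGrowthLE hL ha hG ρ hρ (by linarith) h2

/-! ## §3  The prime-indexed reading (unconditional bookkeeping) -/

/-- `e^{2α·(log q)/2} = q^α` for `q ≥ 1`. [folklore] -/
theorem exp_two_mul_mul_log_half {q : ℕ} (hq : 0 < q) (α : ℝ) :
    Real.exp (2 * α * (Real.log q / 2)) = (q : ℝ) ^ α := by
  rw [Real.rpow_def_of_pos (by exact_mod_cast hq : (0 : ℝ) < q)]
  congr 1
  ring

/-- Bertrand in the window variable: for `t ≥ 0` and any `q₀` with `q₀ ≤ e^{2t}` there is a prime `Q ≥ q₀`, `Q > q₀ − 1`,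
with `t ≤ (log Q)/2` and `Q ≤ 4·e^{2t}`. [folklore: Bertrand's postulate, Mathlib `Nat.exists_prime_lt_and_le_two_mul`] -/
theorem exists_prime_window_ge {t : ℝ} (ht : 0 ≤ t) {q₀ : ℕ} (hq₀ : (q₀ : ℝ) ≤ Real.exp (2 * t)) :
    ∃ Q : ℕ, Q.Prime ∧ q₀ ≤ Q ∧ t ≤ Real.log Q / 2 ∧ (Q : ℝ) ≤ 4 * Real.exp (2 * t) := by
  set n : ℕ := ⌈Real.exp (2 * t)⌉₊ with hn
  have hx1 : 1 ≤ Real.exp (2 * t) := Real.one_le_exp (by positivity)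
  have hn0 : n ≠ 0 := by
    have : 0 < n := Nat.ceil_pos.2 (lt_of_lt_of_le one_pos hx1)
    omega
  obtain ⟨Q, hQ, hnQ, hQ2n⟩ := Nat.exists_prime_lt_and_le_two_mul n hn0
  have hxn : Real.exp (2 * t) ≤ n := Nat.le_ceil _
  have hnx : (n : ℝ) < Real.exp (2 * t) + 1 := Nat.ceil_lt_add_one (Real.exp_nonneg _)
  refine ⟨Q, hQ, ?_, ?_, ?_⟩
  · have : (q₀ : ℝ) < Q := lt_of_le_of_lt (hq₀.trans hxn) (by exact_mod_cast hnQ)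
    exact_mod_cast this.le
  · have hQpos : (0 : ℝ) < Q := by exact_mod_cast hQ.pos
    have h1 : Real.exp (2 * t) ≤ Q := hxn.trans (by exact_mod_cast hnQ.le)
    have h3 : 2 * t ≤ Real.log Q := (Real.le_log_iff_exp_le hQpos).2 h1
    linarith
  · have : (Q : ℝ) ≤ 2 * n := by exact_mod_cast hQ2n
    linarith

/-- **PRIME-INDEXED READING**: `WeilBottomGrowthLE α` (for `α ≥ 0`) iff along the PRIMES `ε((log q)/2) ≥ −C·q^α`
eventually — the window endpoints of the handoff decomposition suffice (every window lies below a prime window at most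
`4×` longer, Bertrand; `ε` is antitone). [this track (theory-1 gen4); Bombieri2000Weil §4 Thm. 5 (monotonicity)] -/
theorem weilBottomGrowthLE_iff_primes (hα : 0 ≤ α) :
    WeilBottomGrowthLE α ↔
      ∃ C : ℝ, ∃ q₀ : ℕ, ∀ q : ℕ, q.Prime → q₀ ≤ q → -C * (q : ℝ) ^ α ≤ weilGroundEnergy (Real.log q / 2) := by
  constructor
  · rintro ⟨C, T, h⟩
    refine ⟨C, ⌈Real.exp (2 * T)⌉₊ + 1, fun q hq hle ↦ ?_⟩
    have := h (Real.log q / 2) (le_log_half_of_ceil_exp_lt hle)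
    rwa [exp_two_mul_mul_log_half hq.pos] at this
  · rintro ⟨C, q₀, h⟩
    -- normalise the constant to be `≥ 0`
    have h' : ∀ q : ℕ, q.Prime → q₀ ≤ q → -(max C 0) * (q : ℝ) ^ α ≤ weilGroundEnergy (Real.log q / 2) := by
      intro q hq hle
      have h2 : -(max C 0) * (q : ℝ) ^ α ≤ -C * (q : ℝ) ^ α :=
        mul_le_mul_of_nonneg_right (neg_le_neg (le_max_left _ _)) (Real.rpow_nonneg q.cast_nonneg _)
      exact h2.trans (h q hq hle)
    refine ⟨max C 0 * (4 : ℝ) ^ α, max (Real.log q₀ / 2) 1, fun t ht ↦ ?_⟩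
    have ht1 : 1 ≤ t := (le_max_right _ _).trans ht
    have ht0 : 0 < t := lt_of_lt_of_le one_pos ht1
    have hq₀x : (q₀ : ℝ) ≤ Real.exp (2 * t) := by
      rcases Nat.eq_zero_or_pos q₀ with rfl | hpos
      · exact_mod_cast (Real.exp_nonneg _)
      · have hlog : Real.log q₀ ≤ 2 * t := by linarith [(le_max_left _ _).trans ht]
        calc (q₀ : ℝ) = Real.exp (Real.log q₀) := (Real.exp_log (by exact_mod_cast hpos)).symm
          _ ≤ Real.exp (2 * t) := Real.exp_le_exp.2 hlog
    obtain ⟨Q, hQ, hq₀Q, htQ, hQ4⟩ := exists_prime_window_ge ht0.le hq₀x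
    have hanti : weilGroundEnergy (Real.log Q / 2) ≤ weilGroundEnergy t := weilGroundEnergy_anti ht0 htQ
    have hQ' := h' Q hQ hq₀Q
    -- `Q^α ≤ (4 e^{2t})^α = 4^α e^{2αt}`
    have hpow : (Q : ℝ) ^ α ≤ (4 : ℝ) ^ α * Real.exp (2 * α * t) := by
      calc (Q : ℝ) ^ α ≤ (4 * Real.exp (2 * t)) ^ α := Real.rpow_le_rpow Q.cast_nonneg hQ4 hα
        _ = (4 : ℝ) ^ α * Real.exp (2 * t) ^ α := Real.mul_rpow (by norm_num) (Real.exp_nonneg _)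
        _ = (4 : ℝ) ^ α * Real.exp (2 * α * t) := by
          rw [← Real.exp_mul]; ring_nf
    have hC0 : 0 ≤ max C 0 := le_max_right _ _
    have := mul_le_mul_of_nonneg_left hpow hC0
    nlinarith

/-! ## §4  The graded door: power-bounded accumulated loss ⟹ a growth class ⟹ a zero-free half-plane -/

/-- **POWER-BOUNDED TOTAL LOSS ⟹ A GROWTH CLASS** (unconditional telescoping): from a rung with loss `ℓ₀ ≥ 0` at a prime
`q₀` (`ε((log q₀)/2) ≥ −ℓ₀`), lossy increments `StepLossy(q, δ_q)` (`δ ≥ 0`) at all primes `q ≥ q₀`, and partial loss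
sums `Σ_{p prime, q₀ ≤ p < Q} δ_p ≤ D·Q^a` (`a, D ≥ 0`), the bottom satisfies `ε(t) ≥ −(ℓ₀ + D·4^a)·e^{2at}` for all
`t ≥ max((log q₀)/2, 1)`, i.e. `WeilBottomGrowthLE a`.  `a = 0`: file II's `neg_le_weilGroundEnergy_of_bounded_loss`.
[this track (theory-1 gen4); Bombieri2000Weil §4 Thm. 5] -/
theorem weilBottomGrowthLE_of_powerBounded_loss {δ : ℕ → ℝ} {q₀ : ℕ} {ℓ₀ D a : ℝ} (hq₀ : q₀.Prime)
    (hℓ₀ : 0 ≤ ℓ₀) (hδ : ∀ q : ℕ, q.Prime → 0 ≤ δ q) (hr : -ℓ₀ ≤ weilGroundEnergy (Real.log q₀ / 2))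
    (h : ∀ q : ℕ, q.Prime → q₀ ≤ q → HandoffStepLossy q (δ q)) (ha : 0 ≤ a) (hD0 : 0 ≤ D)
    (hD : ∀ Q : ℕ, ∑ p ∈ (Finset.Ico q₀ Q).filter Nat.Prime, δ p ≤ D * (Q : ℝ) ^ a) :
    WeilBottomGrowthLE a := by
  refine ⟨ℓ₀ + D * (4 : ℝ) ^ a, max (Real.log q₀ / 2) 1, fun t ht ↦ ?_⟩
  have ht1 : 1 ≤ t := (le_max_right _ _).trans ht
  have ht0 : 0 < t := lt_of_lt_of_le one_pos ht1
  have hq₀x : (q₀ : ℝ) ≤ Real.exp (2 * t) := by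
    have hlog : Real.log q₀ ≤ 2 * t := by linarith [(le_max_left _ _).trans ht]
    calc (q₀ : ℝ) = Real.exp (Real.log q₀) := (Real.exp_log (by exact_mod_cast hq₀.pos)).symm
      _ ≤ Real.exp (2 * t) := Real.exp_le_exp.2 hlog
  obtain ⟨Q, hQ, hq₀Q, htQ, hQ4⟩ := exists_prime_window_ge ht0.le hq₀x
  have h1 := neg_le_weilGroundEnergy_of_forall_handoffStepLossy hq₀ hℓ₀ hδ hr h hQ hq₀Q
  have hanti : weilGroundEnergy (Real.log Q / 2) ≤ weilGroundEnergy t := weilGroundEnergy_anti ht0 htQ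
  have h3 := hD Q
  have hpow : (Q : ℝ) ^ a ≤ (4 : ℝ) ^ a * Real.exp (2 * a * t) := by
    calc (Q : ℝ) ^ a ≤ (4 * Real.exp (2 * t)) ^ a := Real.rpow_le_rpow Q.cast_nonneg hQ4 ha
      _ = (4 : ℝ) ^ a * Real.exp (2 * t) ^ a := Real.mul_rpow (by norm_num) (Real.exp_nonneg _)
      _ = (4 : ℝ) ^ a * Real.exp (2 * a * t) := by
        rw [← Real.exp_mul]; ring_nf
  have hexp1 : 1 ≤ Real.exp (2 * a * t) := Real.one_le_exp (by positivity)
  have h4 : D * (Q : ℝ) ^ a ≤ D * ((4 : ℝ) ^ a * Real.exp (2 * a * t)) := mul_le_mul_of_nonneg_left hpow hD0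
  have h5 : ℓ₀ ≤ ℓ₀ * Real.exp (2 * a * t) := by nlinarith
  nlinarith

/-- **THE GRADED DOOR (conditional headline)**: GRANTED the graded lemma `WeilBottomExpDropOfZero`, a rung with loss at a
prime `q₀` and lossy increments whose accumulated loss is `≤ D·Q^a` (`0 ≤ a`) give the zero-free half-plane
`Re s > ½ + a` (`QuasiRiemannHypothesis (½ + a)`).  HANDOFF-STATEMENT §J.4's MODEL dictionary «a power saving `Q^a` in the
accumulated drop ↔ a zero-free strip», «⟹» half, typed.  Honest size: the trivial modulus gives `a = ½` (vacuous,
`quasiRiemannHypothesis_one`); `a = 0` (bounded total loss) is RH (file II + file V).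
[this track (theory-1 gen4) — conditional on the graded lemma] -/
theorem quasiRiemannHypothesis_of_powerBounded_loss (hL : WeilBottomExpDropOfZero) {δ : ℕ → ℝ} {q₀ : ℕ}
    {ℓ₀ D a : ℝ} (hq₀ : q₀.Prime) (hℓ₀ : 0 ≤ ℓ₀) (hδ : ∀ q : ℕ, q.Prime → 0 ≤ δ q)
    (hr : -ℓ₀ ≤ weilGroundEnergy (Real.log q₀ / 2)) (h : ∀ q : ℕ, q.Prime → q₀ ≤ q → HandoffStepLossy q (δ q))
    (ha : 0 ≤ a) (hD0 : 0 ≤ D) (hD : ∀ Q : ℕ, ∑ p ∈ (Finset.Ico q₀ Q).filter Nat.Prime, δ p ≤ D * (Q : ℝ) ^ a) :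
    QuasiRiemannHypothesis (1 / 2 + a) :=
  quasiRiemannHypothesis_of_weilBottomGrowthLE hL ha
    (weilBottomGrowthLE_of_powerBounded_loss hq₀ hℓ₀ hδ hr h ha hD0 hD)

/-- **SUB-POWER ACCUMULATED LOSS ⟹ RH, granted the graded lemma**: if for EVERY `a > 0` the accumulated loss of some
lossy-increment schedule from a rung is `≤ D_a·Q^a`, then RH. (Each `a` clears `Re s > ½ + a`; §2.)
[this track (theory-1 gen4) — conditional on the graded lemma] -/
theorem riemannHypothesis_of_subpower_loss (hL : WeilBottomExpDropOfZero) {δ : ℕ → ℝ} {q₀ : ℕ} {ℓ₀ : ℝ}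
    (hq₀ : q₀.Prime) (hℓ₀ : 0 ≤ ℓ₀) (hδ : ∀ q : ℕ, q.Prime → 0 ≤ δ q)
    (hr : -ℓ₀ ≤ weilGroundEnergy (Real.log q₀ / 2)) (h : ∀ q : ℕ, q.Prime → q₀ ≤ q → HandoffStepLossy q (δ q))
    (hD : ∀ a : ℝ, 0 < a → ∃ D : ℝ, 0 ≤ D ∧ ∀ Q : ℕ, ∑ p ∈ (Finset.Ico q₀ Q).filter Nat.Prime, δ p ≤ D * (Q : ℝ) ^ a) :
    Summit.RiemannHypothesis := by
  refine (riemannHypothesis_iff_forall_weilBottomGrowthLE hL).2 fun a ha ↦ ?_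
  obtain ⟨D, hD0, hDa⟩ := hD a ha
  exact weilBottomGrowthLE_of_powerBounded_loss hq₀ hℓ₀ hδ hr h ha.le hD0 hDa

end Summit.RiemannHypothesis.RiemannHypothesis.Theorems.HandoffDecomposition

end
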